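import Mathlib.Analysis.Fourier.ZMod
import Mathlib.Analysis.SpecialFunctions.Pow.Real
import Mathlib.Analysis.SpecialFunctions.Log.Basic
import HarnessLib

/-!
# Fractal uncertainty for discrete Cantor sets (Dyatlov–Jin 2017, Lemma 2.2, Lemma 2.6 and Theorem 2)

Analysis/Fourier named-fact file (finite Fourier sandwiches on
`ℤ/N`). S. Dyatlov, L. Jin, *Resonances for open quantum maps and a fractal uncertainty principle*,
Comm. Math. Phys. 354 (2017) 269–316 = arXiv:1608.02238 (held: paper:arxiv-1608.02238, §§1–2.1 read).
Bib key `DyatlovJin2017`.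

Setting (§1.1, §2, verbatim where quoted). `ℤ_N = ℤ/Nℤ`, `ℓ²_N` the functions on it; "the unitary
Fourier transform `ℱ_N u(j) = N^{−1/2} ∑_{ℓ=0}^{N−1} exp(−2πijℓ/N) u(ℓ)`" — i.e. `ℱ_N = N^{−1/2}·𝓕`
for Mathlib's unnormalised `ZMod.dft` (`𝓕 Φ k = ∑_j stdAddChar(−jk) Φ j`). For `X, Y ⊆ ℤ_N` the
sandwich `𝟙_X ℱ_N 𝟙_Y` has operator norm (e:norm-ip)
`sup {|⟨ℱ_N u, v⟩| / (‖u‖‖v‖) : supp u ⊆ Y, supp v ⊆ X}`; equivalently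
`‖𝟙_X ℱ_N 𝟙_Y‖ ≤ r` iff `∑_{k∈X} |𝓕u(k)|² ≤ r² N ‖u‖²` for every `u` supported in `Y` — the form used
below (`FourierSandwichLE`). For `M ≥ 2`, an alphabet `𝒜 ⊆ {0,…,M−1}` with `1 ≤ |𝒜| < M` (the paper
takes `1 < |𝒜|`), `δ = log|𝒜|/log M`, `N = M^k`, the `k`-th order Cantor set is
`𝒞_k = {∑_{j<k} a_j M^j : a_0,…,a_{k−1} ∈ 𝒜} ⊂ ℤ_N` (1.4) and `r_k = ‖𝟙_{𝒞_k} ℱ_N 𝟙_{𝒞_k}‖` (1.5).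

**Lemma 2.2** (verbatim): "Assume that `X₁, Y₁ ⊂ {0,…,N₁−1}`, `X₂, Y₂ ⊂ {0,…,N₂−1}`, and define
`X, Y ⊂ {0,…,N−1} ≃ ℓ²_N` [`N = N₁N₂`] by `X := {j₂ + N₂j₁ | j₁ ∈ X₁, j₂ ∈ X₂}`,
`Y := {ℓ₁ + N₁ℓ₂ | ℓ₁ ∈ Y₁, ℓ₂ ∈ Y₂}`. Then
`‖𝟙_X ℱ_N 𝟙_Y‖ ≤ ‖𝟙_{X₁} ℱ_{N₁} 𝟙_{Y₁}‖ · ‖𝟙_{X₂} ℱ_{N₂} 𝟙_{Y₂}‖`." (FFT splitting, Lemma 2.1; for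
Cantor sets it gives the submultiplicativity `r_{k₁+k₂} ≤ r_{k₁} r_{k₂}` (2.7) and, by Fekete, the
limit of Proposition 2.3.)

**Theorem 2** (verbatim): "There exists a limit, called the fractal uncertainty exponent,
`β = β(M,𝒜) = −lim_{k→∞} log r_k/(k log M) > max(0, 1/2 − δ)` and (1.3) holds for this choice of
`β`." with the consequence (1.6) "`‖𝟙_{𝒞_k} ℱ_N 𝟙_{𝒞_k}‖ ≤ C_ε N^{−β+ε}` for all `ε > 0`"
("fractal uncertainty principle": no function can be supported on `𝒞_k` in both position and
frequency).

**Lemma 2.6** (verbatim, §2.3 "Improvements over the zero bound"): "Assume `X, Y ⊂ ℤ_N` and for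
some `L ∈ {1,…,N−1}`, the following two conditions hold: `|X| ≤ L`; `Y` has a gap of size `L`, that
is there exists `j ∈ ℤ_N` such that `j, …, j+L−1 ∉ Y`, with addition carried in `ℤ_N`. Then
`‖𝟙_X ℱ_N 𝟙_Y‖_{ℓ²_N→ℓ²_N} ≤ √(1 − 2^{−2N})`." (Proof: shift the gap to the top, so `u` supported
in `Y` has generating polynomial of degree `< N − |X|`; Lagrange interpolation at the roots of unity
outside `X`.) With Lemma 2.2 this is the engine of `β > 0` (Corollary 2.7), and it is the one-scale
form of "a window no larger than a gap of the support cannot carry all the Fourier mass" — the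
discrete base case behind the route's porous-set item.

**Vendored**: `FourierSandwichLE N X Y r` (the norm bound in its quadratic form), `radixSetX` / `radixSetY`
(the mixed-radix sets `{j₂ + N₂ j₁}` / `{ℓ₁ + N₁ ℓ₂}` of Lemma 2.2, cast into `ZMod (N₁ N₂)`), `cantorSet M 𝒜 k` (1.4),
and the named facts `dyatlovJin2017_lemma_2_2` (Lemma 2.2 in the equivalent form "bounds `r₁`, `r₂`
for the factors give the bound `r₁r₂` for the product"), `dyatlovJin2017_lemma_2_6` (Lemma 2.6 as printed, the gap
witnessed by `j + i ∉ Y` for `i < L`) and `dyatlovJin2017_fup` (Theorem 2 in the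
form of its consequence (1.6) together with `β > max(0, 1/2 − δ)`; the existence of the LIMIT defining
`β` is not restated — weaker, hence safe). Alphabet hypothesis rendered as `1 ≤ |𝒜| < M` would be
STRONGER than print for `|𝒜| = 1` — so we keep the printed `1 < |𝒜| < M`.

Grounds `Summit.QuantumAdvantage.QuantumAdvantage.Theses.AreaUncertainty.CyclicCantorDecays`
(stmt-QuantumAdvantage-9612: `M = 4`, position alphabet `{0,2}`, frequency alphabet `{0,1}` — DIFFERENT
alphabets, so Theorem 2 does not apply but Lemma 2.2 does, with the level-one norm `1/√2` computed by
hand, exactly the route's proof sketch) and is the discrete model case of `…PorousFUP` (stmt-9607,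
general ν-porous sets: NOT in print in discrete form — Bourgain–Dyatlov 2018 / Dyatlov–Jin 2018 are
continuum statements).

## References

* S. Dyatlov, L. Jin, Comm. Math. Phys. 354 (2017) = arXiv:1608.02238: §1.1 (1.3)–(1.6), **Theorem 2**;
  §2 (2.2)–(2.5); §2.1 Lemma 2.1, **Lemma 2.2**, (2.7), Proposition 2.3; §2.3 **Lemma 2.6**,
  Corollary 2.7. [DyatlovJin2017]
* J. Bourgain, S. Dyatlov, Ann. of Math. 187 (2018) (FUP for δ-regular sets). [BourgainDyatlov2018]
* S. Dyatlov, *An introduction to fractal uncertainty principle*, J. Math. Phys. 60 (2019). [Dyatlov2019]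
-/

noncomputable section

open scoped ZMod
open Finset

namespace Literature.Analysis.Fourier

/-- **The Fourier sandwich bound `‖𝟙_X ℱ_N 𝟙_Y‖ ≤ r`** for the UNITARY discrete Fourier transform
`ℱ_N = N^{−1/2}·𝓕` (Dyatlov–Jin 2017, (2.2)–(2.4)), in quadratic form over Mathlib's unnormalised
`ZMod.dft`: every `u : ℤ/N → ℂ` supported in `Y` (position) has Fourier mass on `X` (frequency)
`∑_{k ∈ X} ‖𝓕u(k)‖² ≤ r² · N · ∑_x ‖u(x)‖²`. [cite: DyatlovJin2017, (2.2)–(2.4) (arXiv:1608.02238 §2)] -/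
def FourierSandwichLE (N : ℕ) [NeZero N] (X Y : Finset (ZMod N)) (r : ℝ) : Prop :=
  ∀ u : ZMod N → ℂ, (∀ x, x ∉ Y → u x = 0) →
    ∑ k ∈ X, ‖ZMod.dft u k‖ ^ 2 ≤ r ^ 2 * (N : ℝ) * ∑ x, ‖u x‖ ^ 2

/-- The mixed-radix set `X` of Lemma 2.2: for `X₁ ⊆ {0,…,N₁−1}`, `X₂ ⊆ {0,…,N₂−1}` (finite
sets of naturals), `radixSetX N₁ N₂ X₁ X₂ = {j₂ + N₂·j₁ : j₁ ∈ X₁, j₂ ∈ X₂} ⊆ ℤ/(N₁N₂)` (frequency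
side). [cite: DyatlovJin2017, Lemma 2.2] -/
def radixSetX (N₁ N₂ : ℕ) (X₁ X₂ : Finset ℕ) : Finset (ZMod (N₁ * N₂)) :=
  (X₁ ×ˢ X₂).image fun p : ℕ × ℕ => ((p.2 + N₂ * p.1 : ℕ) : ZMod (N₁ * N₂))

/-- The mixed-radix set `Y` of Lemma 2.2: `radixSetY N₁ N₂ Y₁ Y₂ = {ℓ₁ + N₁·ℓ₂ : ℓ₁ ∈ Y₁, ℓ₂ ∈ Y₂}
⊆ ℤ/(N₁N₂)` (position side). [cite: DyatlovJin2017, Lemma 2.2] -/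
def radixSetY (N₁ N₂ : ℕ) (Y₁ Y₂ : Finset ℕ) : Finset (ZMod (N₁ * N₂)) :=
  (Y₁ ×ˢ Y₂).image fun p : ℕ × ℕ => ((p.1 + N₁ * p.2 : ℕ) : ZMod (N₁ * N₂))

/-- The `k`-th order discrete Cantor set with base `M` and alphabet `𝒜 ⊆ {0,…,M−1}`:
`𝒞_k(M,𝒜) = {∑_{j<k} a_j M^j : a_j ∈ 𝒜} ⊂ ℤ/M^k` (Dyatlov–Jin 2017, (1.4)). [cite: DyatlovJin2017, (1.4)] -/
def cantorSet (M : ℕ) (𝒜 : Finset ℕ) (k : ℕ) : Finset (ZMod (M ^ k)) :=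
  (Fintype.piFinset fun _ : Fin k => 𝒜).image fun a : Fin k → ℕ => ((∑ j : Fin k, a j * M ^ (j : ℕ) : ℕ) : ZMod (M ^ k))

/-- **Dyatlov–Jin 2017, Lemma 2.2 (submultiplicativity of Fourier sandwiches under FFT splitting).**
For `N = N₁N₂`, `X₁, Y₁ ⊆ {0,…,N₁−1}`, `X₂, Y₂ ⊆ {0,…,N₂−1}` and the mixed-radix sets
`X = {j₂ + N₂j₁ : j₁ ∈ X₁, j₂ ∈ X₂}`, `Y = {ℓ₁ + N₁ℓ₂ : ℓ₁ ∈ Y₁, ℓ₂ ∈ Y₂}` in `ℤ/N`: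
`‖𝟙_X ℱ_N 𝟙_Y‖ ≤ ‖𝟙_{X₁} ℱ_{N₁} 𝟙_{Y₁}‖ · ‖𝟙_{X₂} ℱ_{N₂} 𝟙_{Y₂}‖`, stated as: sandwich bounds
`r₁ ≥ 0` at level `N₁` and `r₂ ≥ 0` at level `N₂` give the bound `r₁r₂` at level `N`. [cite: DyatlovJin2017, Lemma 2.2 (arXiv:1608.02238 §2.1)] -/
def dyatlovJin2017_lemma_2_2 : Prop :=
  ∀ (N₁ N₂ : ℕ) [NeZero N₁] [NeZero N₂] [NeZero (N₁ * N₂)] (X₁ Y₁ X₂ Y₂ : Finset ℕ) (r₁ r₂ : ℝ),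
    (∀ j ∈ X₁, j < N₁) → (∀ j ∈ Y₁, j < N₁) → (∀ j ∈ X₂, j < N₂) → (∀ j ∈ Y₂, j < N₂) →
    0 ≤ r₁ → 0 ≤ r₂ →
    FourierSandwichLE N₁ (X₁.image fun j : ℕ => (j : ZMod N₁)) (Y₁.image fun j : ℕ => (j : ZMod N₁)) r₁ →
    FourierSandwichLE N₂ (X₂.image fun j : ℕ => (j : ZMod N₂)) (Y₂.image fun j : ℕ => (j : ZMod N₂)) r₂ →
    FourierSandwichLE (N₁ * N₂) (radixSetX N₁ N₂ X₁ X₂) (radixSetY N₁ N₂ Y₁ Y₂) (r₁ * r₂)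

/-- **Dyatlov–Jin 2017, Theorem 2 (fractal uncertainty principle for discrete Cantor sets), in the
form of its consequence (1.6).** For every base `M ≥ 2` and alphabet `𝒜 ⊆ {0,…,M−1}` with
`1 < |𝒜| < M` there is an exponent `β > max(0, 1/2 − δ)`, `δ = log|𝒜|/log M`, such that for every
`ε > 0` some constant `C` gives, for all `k` and `N = M^k`,
`‖𝟙_{𝒞_k} ℱ_N 𝟙_{𝒞_k}‖ ≤ C·N^{−β+ε}` — in quadratic form: `u` supported on `𝒞_k` has
`∑_{y ∈ 𝒞_k} ‖𝓕u(y)‖² ≤ C² N^{1−2β+2ε} ‖u‖²`. [cite: DyatlovJin2017, Theorem 2 with (1.6) (arXiv:1608.02238 §1.1)] -/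
def dyatlovJin2017_fup : Prop :=
  ∀ (M : ℕ) (𝒜 : Finset ℕ), 2 ≤ M → (∀ a ∈ 𝒜, a < M) → 1 < 𝒜.card → 𝒜.card < M →
    ∃ β : ℝ, max 0 (1 / 2 - Real.log 𝒜.card / Real.log M) < β ∧
      ∀ ε : ℝ, 0 < ε → ∃ C : ℝ, 0 ≤ C ∧ ∀ (k : ℕ) [NeZero (M ^ k)],
        FourierSandwichLE (M ^ k) (cantorSet M 𝒜 k) (cantorSet M 𝒜 k) (C * ((M : ℝ) ^ k) ^ (-β + ε))

/-- **Dyatlov–Jin 2017, Lemma 2.6 (the gap lemma), as printed.** Let `X, Y ⊆ ℤ/N` and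
`L ∈ {1,…,N−1}` with `|X| ≤ L` (frequency window no larger than `L`) and `Y` (position support)
having a gap of size `L`: some `j ∈ ℤ/N` with `j, j+1, …, j+L−1 ∉ Y` (addition in `ℤ/N`). Then
`‖𝟙_X ℱ_N 𝟙_Y‖ ≤ √(1 − 2^{−2N})`, i.e. the sandwich bound with `r = √(1 − 2^{−2N})`
(`r² N = (1 − 2^{−2N}) N` in the quadratic form). [cite: DyatlovJin2017, Lemma 2.6 (arXiv:1608.02238 §2.3)] -/
def dyatlovJin2017_lemma_2_6 : Prop :=
  ∀ (N : ℕ) [NeZero N] (X Y : Finset (ZMod N)) (L : ℕ), 1 ≤ L → L < N → X.card ≤ L →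
    (∃ j : ZMod N, ∀ i : ℕ, i < L → j + (i : ZMod N) ∉ Y) →
    FourierSandwichLE N X Y (Real.sqrt (1 - (2 : ℝ) ^ (-(2 * (N : ℝ)))))

/-! ### Sanity lemmas -/

/-- Monotonicity of the sandwich bound in `r` (for `0 ≤ r ≤ r'`). [folklore] -/
theorem FourierSandwichLE.mono {N : ℕ} [NeZero N] {X Y : Finset (ZMod N)} {r r' : ℝ}
    (h : FourierSandwichLE N X Y r) (hr : 0 ≤ r) (hrr' : r ≤ r') : FourierSandwichLE N X Y r' := by
  intro u hu
  refine (h u hu).trans ?_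
  have hsum : 0 ≤ ∑ x : ZMod N, ‖u x‖ ^ 2 := Finset.sum_nonneg fun x _ => by positivity
  have hN : (0 : ℝ) ≤ N := Nat.cast_nonneg N
  have : r ^ 2 ≤ r' ^ 2 := pow_le_pow_left₀ hr hrr' 2
  exact mul_le_mul_of_nonneg_right (mul_le_mul_of_nonneg_right this hN) hsum

/-- Shrinking the frequency window keeps a sandwich bound. [folklore] -/
theorem FourierSandwichLE.anti_left {N : ℕ} [NeZero N] {X X' Y : Finset (ZMod N)} {r : ℝ}
    (h : FourierSandwichLE N X Y r) (hX : X' ⊆ X) : FourierSandwichLE N X' Y r := by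
  intro u hu
  refine le_trans ?_ (h u hu)
  exact Finset.sum_le_sum_of_subset_of_nonneg hX fun k _ _ => by positivity


/-! ### Proof of Lemma 2.2 (Dyatlov–Jin 2017, §2.1)

We follow the FFT splitting of [DyatlovJin2017, Lemma 2.1]: writing `ℓ = ℓ₁ + N₁ℓ₂`,
`k = j₂ + N₂j₁` and `ũ_{ℓ₁}(ℓ₂) = u(ℓ₁ + N₁ℓ₂)`,
`𝓕_N u (j₂ + N₂ j₁) = 𝓕_{N₁} W_{j₂} (j₁)` with `W_{j₂}(ℓ₁) = e_N(−j₂ℓ₁) · 𝓕_{N₂} ũ_{ℓ₁} (j₂)`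
(`dft_split` below; this is (2.6) of the paper read off coefficientwise). The printed proof of
Lemma 2.2 then bounds the bilinear form `⟨ℱ_N u, v⟩` by Cauchy–Schwarz and the adjoint bound
`‖𝟙_{Y₁}ℱ*_{N₁}𝟙_{X₁}‖ = ‖𝟙_{X₁}ℱ_{N₁}𝟙_{Y₁}‖`; since our `FourierSandwichLE` is the QUADRATIC form
`∑_{k∈X} |𝓕u(k)|² ≤ r²N‖u‖²`, we instead apply the level-`N₁` bound to each `W_{j₂}`
(supported in `Y₁`) and then the level-`N₂` bound to each slice `ũ_{ℓ₁}` (supported in `Y₂`),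
which is the same computation without the adjoint. In the lemmas below the mixed-radix point
`ℓ₁ + N₁ℓ₂ ∈ ℤ/(N₁N₂)` is written `((a.val + N₁ * b.val : ℕ) : ZMod (N₁ * N₂))` for
`a = ℓ₁ : ZMod N₁`, `b = ℓ₂ : ZMod N₂`, the slice `ũ_{ℓ₁}` is
`fun b => u ((a.val + N₁ * b.val : ℕ) : ZMod (N₁ * N₂))`, and `W_{j₂}` is the function
`fun a => stdAddChar (−(a.val * j₂)) * 𝓕 ũ_a (j₂)` on `ZMod N₁`. -/

section Lemma22Proof

open scoped Real
open Complex

variable {N₁ N₂ : ℕ}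

/-- Mixed-radix uniqueness: `A + N₁·B = A' + N₁·B'` with `A, A' < N₁` forces `A = A'` and
`B = B'`. [folklore] -/
private lemma radix_unique {A A' B B' : ℕ} (hA : A < N₁) (hA' : A' < N₁)
    (h : A + N₁ * B = A' + N₁ * B') : A = A' ∧ B = B' := by
  have hpos : 0 < N₁ := lt_of_le_of_lt (Nat.zero_le _) hA
  have h1 : (A + N₁ * B) / N₁ = B ∧ (A + N₁ * B) % N₁ = A :=
    (Nat.div_mod_unique hpos).mpr ⟨rfl, hA⟩
  have h2 : (A' + N₁ * B') / N₁ = B' ∧ (A' + N₁ * B') % N₁ = A' :=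
    (Nat.div_mod_unique hpos).mpr ⟨rfl, hA'⟩
  rw [h] at h1
  exact ⟨h1.2.symm.trans h2.2, h1.1.symm.trans h2.1⟩

/-- Mixed-radix range: `A + N₁·B < N₁N₂` for `A < N₁`, `B < N₂`. [folklore] -/
private lemma radix_lt {A B : ℕ} (hA : A < N₁) (hB : B < N₂) : A + N₁ * B < N₁ * N₂ := by
  calc A + N₁ * B < N₁ + N₁ * B := by omega
    _ = N₁ * (B + 1) := by ring
    _ ≤ N₁ * N₂ := Nat.mul_le_mul_left _ hB

/-- Naturals below `N` are separated by the cast into `ZMod N`. [folklore] -/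
private lemma natCast_zmod_inj_of_lt {N m n : ℕ} (hm : m < N) (hn : n < N)
    (h : (m : ZMod N) = (n : ZMod N)) : m = n := by
  have := congrArg ZMod.val h
  rwa [ZMod.val_cast_of_lt hm, ZMod.val_cast_of_lt hn] at this

/-- The mixed-radix reindexing `(ℓ₁, ℓ₂) ↦ ℓ₁ + N₁ℓ₂` of `ℤ/N₁ × ℤ/N₂` onto `ℤ/(N₁N₂)` is a
bijection (the position-side splitting used in the proof of Lemma 2.1).
[cite: DyatlovJin2017, Lemma 2.1 (arXiv:1608.02238 §2.1)] -/
private lemma mixedRadix_bijective [NeZero N₁] [NeZero N₂] [NeZero (N₁ * N₂)] :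
    Function.Bijective
      (fun p : ZMod N₁ × ZMod N₂ => ((p.1.val + N₁ * p.2.val : ℕ) : ZMod (N₁ * N₂))) := by
  rw [Fintype.bijective_iff_injective_and_card]
  refine ⟨?_, by simp [ZMod.card]⟩
  rintro ⟨a, b⟩ ⟨a', b'⟩ h
  have h' := natCast_zmod_inj_of_lt (radix_lt a.val_lt b.val_lt) (radix_lt a'.val_lt b'.val_lt) h
  obtain ⟨h1, h2⟩ := radix_unique a.val_lt a'.val_lt h'
  exact Prod.ext (ZMod.val_injective _ h1) (ZMod.val_injective _ h2)

/-- Summing over `ℤ/(N₁N₂)` through the mixed-radix reindexing `ℓ = ℓ₁ + N₁ℓ₂`. [folklore] -/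
private lemma sum_mixedRadix [NeZero N₁] [NeZero N₂] [NeZero (N₁ * N₂)] {M : Type*}
    [AddCommMonoid M] (g : ZMod (N₁ * N₂) → M) :
    ∑ x, g x = ∑ a : ZMod N₁, ∑ b : ZMod N₂, g ((a.val + N₁ * b.val : ℕ) : ZMod (N₁ * N₂)) := by
  rw [← (mixedRadix_bijective (N₁ := N₁) (N₂ := N₂)).sum_comp g, Fintype.sum_prod_type]

/-- The character identity behind the FFT splitting:
`e_N(−(A + N₁B)(j₂ + N₂j₁)) = e_{N₁}(−A j₁) · e_N(−A j₂) · e_{N₂}(−B j₂)` (the cross term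
`e(−B j₁)` equals `1`). [cite: DyatlovJin2017, proof of Lemma 2.1 (arXiv:1608.02238 §2.1)] -/
private lemma char_split_nat [NeZero N₁] [NeZero N₂] [NeZero (N₁ * N₂)] (A B j₁ j₂ : ℕ) :
    ZMod.stdAddChar (-(((A + N₁ * B : ℕ) : ZMod (N₁ * N₂)) * ((j₂ + N₂ * j₁ : ℕ) : ZMod (N₁ * N₂))))
      = ZMod.stdAddChar (-((A : ZMod N₁) * (j₁ : ZMod N₁))) *
        (ZMod.stdAddChar (-((A * j₂ : ℕ) : ZMod (N₁ * N₂))) *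
          ZMod.stdAddChar (-((B : ZMod N₂) * (j₂ : ZMod N₂)))) := by
  have e1 : (-(((A + N₁ * B : ℕ) : ZMod (N₁ * N₂)) * ((j₂ + N₂ * j₁ : ℕ) : ZMod (N₁ * N₂))))
      = ((-((A + N₁ * B) * (j₂ + N₂ * j₁) : ℤ) : ℤ) : ZMod (N₁ * N₂)) := by push_cast; ring
  have e2 : (-((A : ZMod N₁) * (j₁ : ZMod N₁))) = ((-(A * j₁ : ℤ) : ℤ) : ZMod N₁) := by
    push_cast; ring
  have e3 : (-((A * j₂ : ℕ) : ZMod (N₁ * N₂))) = ((-(A * j₂ : ℤ) : ℤ) : ZMod (N₁ * N₂)) := by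
    push_cast; ring
  have e4 : (-((B : ZMod N₂) * (j₂ : ZMod N₂))) = ((-(B * j₂ : ℤ) : ℤ) : ZMod N₂) := by
    push_cast; ring
  rw [e1, e2, e3, e4, ZMod.stdAddChar_coe, ZMod.stdAddChar_coe, ZMod.stdAddChar_coe,
    ZMod.stdAddChar_coe, ← Complex.exp_add, ← Complex.exp_add]
  have hN₁ : (N₁ : ℂ) ≠ 0 := Nat.cast_ne_zero.mpr (NeZero.ne N₁)
  have hN₂ : (N₂ : ℂ) ≠ 0 := Nat.cast_ne_zero.mpr (NeZero.ne N₂)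
  have key : 2 * π * I * ((-((A + N₁ * B) * (j₂ + N₂ * j₁) : ℤ) : ℤ) : ℂ) / ((N₁ * N₂ : ℕ) : ℂ)
      = (2 * π * I * ((-(A * j₁ : ℤ) : ℤ) : ℂ) / (N₁ : ℂ)
          + (2 * π * I * ((-(A * j₂ : ℤ) : ℤ) : ℂ) / ((N₁ * N₂ : ℕ) : ℂ)
            + 2 * π * I * ((-(B * j₂ : ℤ) : ℤ) : ℂ) / (N₂ : ℂ)))
        + ((-(B * j₁ : ℤ) : ℤ) : ℂ) * (2 * π * I) := by
    push_cast
    field_simp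
    ring
  rw [key, Complex.exp_add, Complex.exp_int_mul_two_pi_mul_I, mul_one]

/-- **[DyatlovJin2017, Lemma 2.1], coefficientwise (FFT splitting, (2.6)).** With the slices
`ũ_{ℓ₁}(ℓ₂) = u(ℓ₁ + N₁ℓ₂)` and `W_{j₂}(ℓ₁) = e_N(−j₂ℓ₁) · 𝓕_{N₂} ũ_{ℓ₁} (j₂)`:
`𝓕_N u (j₂ + N₂j₁) = 𝓕_{N₁} W_{j₂} (j₁)`.
[cite: DyatlovJin2017, Lemma 2.1 (arXiv:1608.02238 §2.1)] -/
private lemma dft_split [NeZero N₁] [NeZero N₂] [NeZero (N₁ * N₂)] (u : ZMod (N₁ * N₂) → ℂ)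
    (j₁ j₂ : ℕ) :
    𝓕 u ((j₂ + N₂ * j₁ : ℕ) : ZMod (N₁ * N₂))
      = 𝓕 (fun a : ZMod N₁ => ZMod.stdAddChar (-((a.val * j₂ : ℕ) : ZMod (N₁ * N₂))) *
          𝓕 (fun b : ZMod N₂ => u ((a.val + N₁ * b.val : ℕ) : ZMod (N₁ * N₂))) (j₂ : ZMod N₂))
        (j₁ : ZMod N₁) := by
  rw [ZMod.dft_apply, ZMod.dft_apply, sum_mixedRadix]
  refine Finset.sum_congr rfl fun a _ => ?_
  simp only [ZMod.dft_apply, smul_eq_mul, Finset.mul_sum]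
  refine Finset.sum_congr rfl fun b _ => ?_
  have hc := char_split_nat (N₁ := N₁) (N₂ := N₂) a.val b.val j₁ j₂
  rw [ZMod.natCast_zmod_val, ZMod.natCast_zmod_val] at hc
  rw [hc]
  ring

/-- Support transfer [DyatlovJin2017, proof of Lemma 2.2]: if `u` is supported in
`Y = {ℓ₁ + N₁ℓ₂ : ℓ₁ ∈ Y₁, ℓ₂ ∈ Y₂}` then `ũ_{ℓ₁}(ℓ₂) = u(ℓ₁ + N₁ℓ₂) = 0` unless `ℓ₁ ∈ Y₁` and
`ℓ₂ ∈ Y₂`. [cite: DyatlovJin2017, proof of Lemma 2.2 (arXiv:1608.02238 §2.1)] -/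
private lemma slice_eq_zero [NeZero N₁] [NeZero N₂] [NeZero (N₁ * N₂)] {Y₁ Y₂ : Finset ℕ}
    (hY₁ : ∀ j ∈ Y₁, j < N₁) (hY₂ : ∀ j ∈ Y₂, j < N₂) {u : ZMod (N₁ * N₂) → ℂ}
    (hu : ∀ x, x ∉ radixSetY N₁ N₂ Y₁ Y₂ → u x = 0) (a : ZMod N₁) (b : ZMod N₂)
    (hab : a ∉ Y₁.image (fun j : ℕ => (j : ZMod N₁)) ∨ b ∉ Y₂.image (fun j : ℕ => (j : ZMod N₂))) :
    u ((a.val + N₁ * b.val : ℕ) : ZMod (N₁ * N₂)) = 0 := by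
  refine hu _ fun hmem => ?_
  simp only [radixSetY, Finset.mem_image, Finset.mem_product] at hmem
  obtain ⟨⟨l₁, l₂⟩, ⟨h₁, h₂⟩, h⟩ := hmem
  have h' := natCast_zmod_inj_of_lt (radix_lt (hY₁ l₁ h₁) (hY₂ l₂ h₂))
    (radix_lt a.val_lt b.val_lt) h
  obtain ⟨e₁, e₂⟩ := radix_unique (hY₁ l₁ h₁) a.val_lt h'
  rcases hab with ha | hb
  · exact ha (Finset.mem_image.mpr ⟨l₁, h₁, by rw [e₁, ZMod.natCast_zmod_val]⟩)
  · exact hb (Finset.mem_image.mpr ⟨l₂, h₂, by rw [e₂, ZMod.natCast_zmod_val]⟩)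

/-- Reindexing a sum over the cast image in `ZMod N` of a set of naturals below `N`.
[folklore] -/
private lemma sum_image_natCast {N : ℕ} {S : Finset ℕ} (hS : ∀ j ∈ S, j < N) (g : ZMod N → ℝ) :
    ∑ k ∈ S.image (fun j : ℕ => (j : ZMod N)), g k = ∑ j ∈ S, g (j : ZMod N) := by
  rw [Finset.sum_image]
  intro m hm n hn h
  exact natCast_zmod_inj_of_lt (hS m hm) (hS n hn) h

/-- Reindexing the sum over the frequency set `X = {j₂ + N₂j₁ : j₁ ∈ X₁, j₂ ∈ X₂}` of
Lemma 2.2 as a double sum over `X₁ × X₂`. [folklore] -/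
private lemma sum_radixSetX {X₁ X₂ : Finset ℕ} (hX₁ : ∀ j ∈ X₁, j < N₁)
    (hX₂ : ∀ j ∈ X₂, j < N₂) (g : ZMod (N₁ * N₂) → ℝ) :
    ∑ k ∈ radixSetX N₁ N₂ X₁ X₂, g k
      = ∑ j₁ ∈ X₁, ∑ j₂ ∈ X₂, g ((j₂ + N₂ * j₁ : ℕ) : ZMod (N₁ * N₂)) := by
  rw [radixSetX, Finset.sum_image, Finset.sum_product]
  rintro ⟨m₁, m₂⟩ hm ⟨n₁, n₂⟩ hn h
  simp only [Finset.coe_product, Set.mem_prod, Finset.mem_coe] at hm hn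
  have hm' : m₂ + N₂ * m₁ < N₁ * N₂ := by
    rw [mul_comm N₁]; exact radix_lt (hX₂ _ hm.2) (hX₁ _ hm.1)
  have hn' : n₂ + N₂ * n₁ < N₁ * N₂ := by
    rw [mul_comm N₁]; exact radix_lt (hX₂ _ hn.2) (hX₁ _ hn.1)
  have h' := natCast_zmod_inj_of_lt hm' hn' h
  obtain ⟨e₂, e₁⟩ := radix_unique (hX₂ _ hm.2) (hX₂ _ hn.2) h'
  rw [e₁, e₂]

/-- **Dyatlov–Jin 2017, Lemma 2.2** holds: the Fourier sandwich bound is submultiplicative under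
the FFT splitting `N = N₁N₂`, `X = {j₂ + N₂j₁}`, `Y = {ℓ₁ + N₁ℓ₂}`. Proof: split `𝓕_N u` by
Lemma 2.1 (`dft_split`), apply the level-`N₁` bound to each `W_{j₂}` (supported in `Y₁`), then
the level-`N₂` bound to each slice `ũ_{ℓ₁}` (supported in `Y₂`), and reassemble `‖u‖²` over the
mixed-radix bijection.
[cite: DyatlovJin2017, Lemma 2.2 with Lemma 2.1 (arXiv:1608.02238 §2.1, pp. 10–11)] -/
theorem dyatlovJin2017_lemma_2_2_holds : dyatlovJin2017_lemma_2_2 := by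
  intro N₁ N₂ _ _ _ X₁ Y₁ X₂ Y₂ r₁ r₂ hX₁ hY₁ hX₂ hY₂ _hr₁ _hr₂ h₁ h₂ u hu
  -- (2.6): reindex the frequency side and split the transform (Lemma 2.1)
  have step1 : ∑ k ∈ radixSetX N₁ N₂ X₁ X₂, ‖𝓕 u k‖ ^ 2
      = ∑ j₂ ∈ X₂, ∑ j₁ ∈ X₁,
          ‖𝓕 (fun a : ZMod N₁ => ZMod.stdAddChar (-((a.val * j₂ : ℕ) : ZMod (N₁ * N₂))) *
              𝓕 (fun b : ZMod N₂ => u ((a.val + N₁ * b.val : ℕ) : ZMod (N₁ * N₂))) (j₂ : ZMod N₂))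
            (j₁ : ZMod N₁)‖ ^ 2 := by
    rw [sum_radixSetX hX₁ hX₂, Finset.sum_comm]
    refine Finset.sum_congr rfl fun j₂ _ => Finset.sum_congr rfl fun j₁ _ => ?_
    rw [dft_split]
  -- the level-`N₁` bound applied to each `W_{j₂}`, which is supported in `Y₁`; the twiddle
  -- factor is unimodular, so `‖W_{j₂}(ℓ₁)‖ = ‖𝓕_{N₂} ũ_{ℓ₁} (j₂)‖`
  have step2 : ∀ j₂ : ℕ, ∑ j₁ ∈ X₁,
      ‖𝓕 (fun a : ZMod N₁ => ZMod.stdAddChar (-((a.val * j₂ : ℕ) : ZMod (N₁ * N₂))) *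
          𝓕 (fun b : ZMod N₂ => u ((a.val + N₁ * b.val : ℕ) : ZMod (N₁ * N₂))) (j₂ : ZMod N₂))
        (j₁ : ZMod N₁)‖ ^ 2
      ≤ r₁ ^ 2 * N₁ * ∑ a : ZMod N₁,
          ‖𝓕 (fun b : ZMod N₂ => u ((a.val + N₁ * b.val : ℕ) : ZMod (N₁ * N₂)))
            (j₂ : ZMod N₂)‖ ^ 2 := by
    intro j₂
    have hW := h₁
      (fun a : ZMod N₁ => ZMod.stdAddChar (-((a.val * j₂ : ℕ) : ZMod (N₁ * N₂))) *
        𝓕 (fun b : ZMod N₂ => u ((a.val + N₁ * b.val : ℕ) : ZMod (N₁ * N₂))) (j₂ : ZMod N₂))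
      (fun a ha => by
        have h0 : (fun b : ZMod N₂ => u ((a.val + N₁ * b.val : ℕ) : ZMod (N₁ * N₂))) = 0 :=
          funext fun b => slice_eq_zero hY₁ hY₂ hu a b (Or.inl ha)
        rw [h0, map_zero, Pi.zero_apply, mul_zero])
    rw [sum_image_natCast hX₁] at hW
    refine hW.trans (le_of_eq ?_)
    congr 1
    refine Finset.sum_congr rfl fun a _ => ?_
    rw [norm_mul, ZMod.stdAddChar_apply, Circle.norm_coe, one_mul]
  -- the level-`N₂` bound applied to each slice `ũ_{ℓ₁}`, which is supported in `Y₂`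
  have step3 : ∀ a : ZMod N₁, ∑ j₂ ∈ X₂,
      ‖𝓕 (fun b : ZMod N₂ => u ((a.val + N₁ * b.val : ℕ) : ZMod (N₁ * N₂))) (j₂ : ZMod N₂)‖ ^ 2
      ≤ r₂ ^ 2 * N₂ * ∑ b : ZMod N₂, ‖u ((a.val + N₁ * b.val : ℕ) : ZMod (N₁ * N₂))‖ ^ 2 := by
    intro a
    have hU := h₂ (fun b : ZMod N₂ => u ((a.val + N₁ * b.val : ℕ) : ZMod (N₁ * N₂)))
      (fun b hb => slice_eq_zero hY₁ hY₂ hu a b (Or.inr hb))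
    rwa [sum_image_natCast hX₂] at hU
  -- `‖u‖²` through the mixed-radix reindexing
  have step4 : ∑ x : ZMod (N₁ * N₂), ‖u x‖ ^ 2
      = ∑ a : ZMod N₁, ∑ b : ZMod N₂, ‖u ((a.val + N₁ * b.val : ℕ) : ZMod (N₁ * N₂))‖ ^ 2 :=
    sum_mixedRadix (fun x => ‖u x‖ ^ 2)
  have hc₁ : (0 : ℝ) ≤ r₁ ^ 2 * N₁ := by positivity
  calc ∑ k ∈ radixSetX N₁ N₂ X₁ X₂, ‖𝓕 u k‖ ^ 2
      = ∑ j₂ ∈ X₂, ∑ j₁ ∈ X₁,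
          ‖𝓕 (fun a : ZMod N₁ => ZMod.stdAddChar (-((a.val * j₂ : ℕ) : ZMod (N₁ * N₂))) *
              𝓕 (fun b : ZMod N₂ => u ((a.val + N₁ * b.val : ℕ) : ZMod (N₁ * N₂))) (j₂ : ZMod N₂))
            (j₁ : ZMod N₁)‖ ^ 2 := step1
    _ ≤ ∑ j₂ ∈ X₂, r₁ ^ 2 * N₁ * ∑ a : ZMod N₁,
          ‖𝓕 (fun b : ZMod N₂ => u ((a.val + N₁ * b.val : ℕ) : ZMod (N₁ * N₂)))
            (j₂ : ZMod N₂)‖ ^ 2 :=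
        Finset.sum_le_sum fun j₂ _ => step2 j₂
    _ = r₁ ^ 2 * N₁ * ∑ a : ZMod N₁, ∑ j₂ ∈ X₂,
          ‖𝓕 (fun b : ZMod N₂ => u ((a.val + N₁ * b.val : ℕ) : ZMod (N₁ * N₂)))
            (j₂ : ZMod N₂)‖ ^ 2 := by
        rw [← Finset.mul_sum, Finset.sum_comm]
    _ ≤ r₁ ^ 2 * N₁ * ∑ a : ZMod N₁,
          (r₂ ^ 2 * N₂ * ∑ b : ZMod N₂, ‖u ((a.val + N₁ * b.val : ℕ) : ZMod (N₁ * N₂))‖ ^ 2) :=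
        mul_le_mul_of_nonneg_left (Finset.sum_le_sum fun a _ => step3 a) hc₁
    _ = (r₁ * r₂) ^ 2 * ((N₁ * N₂ : ℕ) : ℝ) * ∑ x : ZMod (N₁ * N₂), ‖u x‖ ^ 2 := by
        rw [step4, ← Finset.mul_sum]; push_cast; ring

end Lemma22Proof

end Literature.Analysis.Fourier

end
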